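import Mathlib
import Summits.AtomisticToContinuum.FouriersLaw.Theses.BondHeatUncertainty
import Summits.AtomisticToContinuum.FouriersLaw.Theses.JunctionLocality
import Summits.AtomisticToContinuum.FouriersLaw.Theorems.JunctionLocalityHarmonicCalibration

/-!
# Route `BondHeatUncertainty` — the import slot `PositiveOrInfiniteLimit` at the integrable corner

Support (calibration) for item `stmt-AtomisticToContinuum-9128`
(`Summit.AtomisticToContinuum.FouriersLaw.Theses.BondHeatUncertainty.PositiveOrInfiniteLimit`: the
response coefficients `D N` converge in `EReal` to some `ℓ ∈ (0, +∞]`). The slot deliberately allows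
the value `ℓ = ⊤` ("perfect conductor"); finiteness is the job of the separate waypoint `BoundedResponse`.
This file shows, from PROVED tree facts only, that the `⊤` branch is REALISED inside the `pinnedChain`
family at its integrable corner `lam = β = 0` (the pinned HARMONIC chain, outside the conjunct's range
`lam, β > 0`): along the Gaussian steady-state family of `JunctionLocality.HarmonicCalibration`
(item 11753, proved: `harmonicCalibration_proof`) EVERY sequence of response coefficients — the
`δ`-limits along `𝓝[≠] 0` are unique — tends to `⊤` in `EReal`, because the resistances
`(N-1)/D N` are bounded while `D N > 0` (`D N = (N-1)·fluxCoeff ω₂ γ N ≥ (N-1)·fluxLimit ω₂ γ/2`,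
ballistic transport, Rieder–Lebowitz–Lieb 1967 / BLR 2000 §6.2). Consequences recorded by name:

* `ereal_tendsto_top_of_resistance_le` — abstract: `D N > 0` and `(N-1)/D N ≤ B` for `N ≥ 2` force
  `↑(D N) → ⊤`.
* `harmonic_response_tendsto_top_of_harmonicCalibration : JunctionLocality.HarmonicCalibration → …` and
  its discharge `harmonic_response_tendsto_top` — along the harmonic family the slot's conclusion holds
  with `ℓ = ⊤` and bounded response FAILS (`harmonic_positiveOrInfinite_and_unbounded`): the slot is
  strictly weaker than clause (ii) of `FouriersLawFor` and does not imply `BoundedResponse` — the two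
  halves of the conjunct are independent, as the route text asserts ("together with BoundedResponse it
  gives `D N → κ ∈ (0,∞)`").

Nothing here closes item 9128 (open-problem content for `lam, β > 0`).
-/

noncomputable section

open Filter Topology Set MeasureTheory

namespace Summit.AtomisticToContinuum.FouriersLaw.Theorems.PositiveOrInfiniteLimit

open Summit.AtomisticToContinuum.FouriersLaw.Theses
open Literature.MathematicalPhysics.KineticTheory.HeatConduction

/-! ## Bounded resistance forces the `⊤` branch -/

/-- **Bounded resistances + positive conductances ⇒ `D N → ⊤` in `EReal`.** If `D N > 0` and
`(N-1)/D N ≤ B` for all `N ≥ 2`, then `D N ≥ (N-1)/B` with `B > 0`, so `D N → +∞`, i.e.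
`↑(D N) → ⊤` (`EReal.tendsto_nhds_top_iff_real`). [folklore] -/
theorem ereal_tendsto_top_of_resistance_le (D : ℕ → ℝ) (B : ℝ)
    (hpos : ∀ N : ℕ, 2 ≤ N → 0 < D N) (hB : ∀ N : ℕ, 2 ≤ N → ((N : ℝ) - 1) / D N ≤ B) :
    Tendsto (fun N : ℕ => ((D N : ℝ) : EReal)) atTop (𝓝 ⊤) := by
  -- `B > 0`, from `N = 2`
  have hBpos : 0 < B := by
    have h2 := hB 2 le_rfl
    have hD2 := hpos 2 le_rfl
    have : (0 : ℝ) < ((2 : ℕ) : ℝ) - 1 := by norm_num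
    exact lt_of_lt_of_le (div_pos this hD2) h2
  -- `D N ≥ (N-1)/B` for `N ≥ 2`
  have hlow : ∀ N : ℕ, 2 ≤ N → ((N : ℝ) - 1) / B ≤ D N := by
    intro N hN
    have hD := hpos N hN
    have h := hB N hN
    rw [div_le_iff₀ hD] at h
    rw [div_le_iff₀ hBpos]
    linarith [mul_comm B (D N)]
  -- `(N-1)/B → +∞`
  have hdiv : Tendsto (fun N : ℕ => ((N : ℝ) - 1) / B) atTop atTop := by
    refine Tendsto.atTop_div_const hBpos ?_
    exact tendsto_atTop_add_const_right atTop (-1) tendsto_natCast_atTop_atTop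
  have hD : Tendsto D atTop atTop :=
    tendsto_atTop_mono' atTop (by
      filter_upwards [eventually_ge_atTop 2] with N hN
      exact hlow N hN) hdiv
  refine EReal.tendsto_nhds_top_iff_real.2 fun x => ?_
  filter_upwards [hD.eventually_gt_atTop x] with N hN
  exact EReal.coe_lt_coe_iff.2 hN

/-! ## The harmonic family: every response sequence tends to `⊤` -/

/-- **`HarmonicCalibration` ⇒ the `⊤` branch of the slot at `lam = β = 0`.** From the route decl
`JunctionLocality.HarmonicCalibration` (by name): for `ω₂, γ > 0` there is a steady-state family `μ` of
`pinnedChain ω₂ 0 0 γ` (all `N`, all `T_L, T_R > 0`) such that for every `T > 0` and EVERY `D` with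
`totalCurrent (μ N (T+δ/2) (T-δ/2))/δ → D N` along `𝓝[≠] 0` (all `N`), `↑(D N) → ⊤` in `EReal`.
Proof: the calibration supplies such a family with SOME response sequence `D₀`, positive for `N ≥ 2`
and with bounded resistances; `D = D₀` by uniqueness of limits along the proper filter `𝓝[≠] 0`, and
`ereal_tendsto_top_of_resistance_le` concludes. [folklore] -/
theorem harmonic_response_tendsto_top_of_harmonicCalibration
    (h : JunctionLocality.HarmonicCalibration) {ω₂ γ : ℝ} (hω : 0 < ω₂) (hγ : 0 < γ) :
    ∃ μ : (N : ℕ) → ℝ → ℝ → Measure (PhaseSpace N),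
      (∀ (N : ℕ) (T_L T_R : ℝ), 0 < T_L → 0 < T_R →
        (pinnedChain ω₂ 0 0 γ).IsSteadyState N T_L T_R (μ N T_L T_R)) ∧
      ∀ T : ℝ, 0 < T → ∀ D : ℕ → ℝ,
        (∀ N : ℕ, Tendsto (fun δ : ℝ =>
          (pinnedChain ω₂ 0 0 γ).totalCurrent (μ N (T + δ / 2) (T - δ / 2)) / δ)
            (𝓝[≠] 0) (𝓝 (D N))) →
        Tendsto (fun N : ℕ => ((D N : ℝ) : EReal)) atTop (𝓝 ⊤) := by
  obtain ⟨μ, hμ, hT⟩ := h ω₂ γ hω hγ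
  refine ⟨μ, hμ, fun T hTpos D hD => ?_⟩
  obtain ⟨D₀, hD₀, hpos, -, B, hB⟩ := hT T hTpos
  have hDD : D = D₀ := funext fun N => tendsto_nhds_unique (hD N) (hD₀ N)
  subst hDD
  exact ereal_tendsto_top_of_resistance_le D B hpos hB

/-- **The `⊤` branch, discharged**: the previous statement with `HarmonicCalibration` supplied by its
in-tree proof `JunctionLocality.harmonicCalibration_proof` (item 11753) — unconditional. [folklore] -/
theorem harmonic_response_tendsto_top {ω₂ γ : ℝ} (hω : 0 < ω₂) (hγ : 0 < γ) :
    ∃ μ : (N : ℕ) → ℝ → ℝ → Measure (PhaseSpace N),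
      (∀ (N : ℕ) (T_L T_R : ℝ), 0 < T_L → 0 < T_R →
        (pinnedChain ω₂ 0 0 γ).IsSteadyState N T_L T_R (μ N T_L T_R)) ∧
      ∀ T : ℝ, 0 < T → ∀ D : ℕ → ℝ,
        (∀ N : ℕ, Tendsto (fun δ : ℝ =>
          (pinnedChain ω₂ 0 0 γ).totalCurrent (μ N (T + δ / 2) (T - δ / 2)) / δ)
            (𝓝[≠] 0) (𝓝 (D N))) →
        Tendsto (fun N : ℕ => ((D N : ℝ) : EReal)) atTop (𝓝 ⊤) :=
  harmonic_response_tendsto_top_of_harmonicCalibration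
    Theorems.JunctionLocality.harmonicCalibration_proof hω hγ

/-- **Calibration of the slot's conclusion at the integrable corner.** For the pinned harmonic chain
(`ω₂, γ > 0`, `lam = β = 0`) there is a steady-state family along which, for every `T > 0`, response
coefficients EXIST and every response sequence satisfies the conclusion of `PositiveOrInfiniteLimit`
— `∃ ℓ : EReal, 0 < ℓ ∧ ↑(D N) → ℓ` — with `ℓ = ⊤`, while `BddAbove (range |D ·|)` FAILS: the slot
holds in its infinite branch exactly where bounded response (and Fourier's law) fail, so it does not
imply `BoundedResponse`. [folklore] -/
theorem harmonic_positiveOrInfinite_and_unbounded {ω₂ γ : ℝ} (hω : 0 < ω₂) (hγ : 0 < γ) :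
    ∃ μ : (N : ℕ) → ℝ → ℝ → Measure (PhaseSpace N),
      (∀ (N : ℕ) (T_L T_R : ℝ), 0 < T_L → 0 < T_R →
        (pinnedChain ω₂ 0 0 γ).IsSteadyState N T_L T_R (μ N T_L T_R)) ∧
      ∀ T : ℝ, 0 < T →
        (∃ D : ℕ → ℝ, ∀ N : ℕ, Tendsto (fun δ : ℝ =>
          (pinnedChain ω₂ 0 0 γ).totalCurrent (μ N (T + δ / 2) (T - δ / 2)) / δ)
            (𝓝[≠] 0) (𝓝 (D N))) ∧
        ∀ D : ℕ → ℝ,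
          (∀ N : ℕ, Tendsto (fun δ : ℝ =>
            (pinnedChain ω₂ 0 0 γ).totalCurrent (μ N (T + δ / 2) (T - δ / 2)) / δ)
              (𝓝[≠] 0) (𝓝 (D N))) →
          (∃ ℓ : EReal, 0 < ℓ ∧ Tendsto (fun N : ℕ => ((D N : ℝ) : EReal)) atTop (𝓝 ℓ)) ∧
            ¬ BddAbove (Set.range fun N => |D N|) := by
  obtain ⟨μ, hμ, hT⟩ := Theorems.JunctionLocality.harmonicCalibration_proof ω₂ γ hω hγ
  refine ⟨μ, hμ, fun T hTpos => ?_⟩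
  obtain ⟨D₀, hD₀, hpos, -, B, hB⟩ := hT T hTpos
  refine ⟨⟨D₀, hD₀⟩, fun D hD => ?_⟩
  have hDD : D = D₀ := funext fun N => tendsto_nhds_unique (hD N) (hD₀ N)
  subst hDD
  have htop := ereal_tendsto_top_of_resistance_le D B hpos hB
  refine ⟨⟨⊤, EReal.zero_lt_top, htop⟩, ?_⟩
  -- an `EReal` limit `⊤` is incompatible with a bound `|D N| ≤ S`
  rintro ⟨S, hS⟩
  have hDle : ∀ N : ℕ, ((D N : ℝ) : EReal) ≤ ((S : ℝ) : EReal) := fun N =>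
    EReal.coe_le_coe_iff.2 ((le_abs_self _).trans (hS ⟨N, rfl⟩))
  have hle : (⊤ : EReal) ≤ ((S : ℝ) : EReal) := le_of_tendsto' htop hDle
  exact EReal.coe_ne_top S (top_le_iff.1 hle)

end Summit.AtomisticToContinuum.FouriersLaw.Theorems.PositiveOrInfiniteLimit

end
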